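import Summits.Ventures.DiscreteObjects.Hadamard.CompositeOrderStructure668B
import Summits.Ventures.DiscreteObjects.Hadamard.ElemAbelianRank2FixedGram

/-!
# Hadamard 668 census, family F12 — two moduli at once: the fixed-row sums of an element of order `pq`, and
# ORDER 123 ⇒ the element is fixed-point-free with its 3-part fixing exactly 164 rows / columns (kernel, structure)

Framing: lottery ticket; floor = certified bounds/negative ranges.

Cell pub-namedobj (venture DiscreteObjects), target (H), hadamard gen 18.  For a signed automorphism `(π, κ, d, e)` of
a Hadamard matrix with `π^(pq) = κ^(pq) = 1` (`p ≠ q` primes) and two distinct rows `x ≠ x'` fixed by BOTH parts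
`π^p`, `π^q`, the product function `h = H x · H x' ·` is invariant under `κ^p` and `κ^q` (signs pinned by a fixed column
of each part), hence (`composite_pair_dvd`):
  `q ∣ Σ_{Fix κ^p} h`, `p ∣ Σ_{Fix κ^q} h` (fixed blocks of the two prime-order parts, gen 17 `fixedRows_inner_dvd`),
  `p ∣ Σ_{Fix κ^p ∖ Fix κ^q} h`, `q ∣ Σ_{Fix κ^q ∖ Fix κ^p} h` (orbits of one part inside the fixed set of the other,
  `dvd_sum_fixed_moved`).
Together with the trivial bounds (a `±1`-sum over `s` columns has absolute value `≤ s` and the parity of `s`) this is a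
small integer system per counting case; exact enumeration (pub-namedobj-hadamard-g18/code/composite_crt_g18.py, one
implementation, guidance only) finds it INFEASIBLE for order 123 case `(f₃, f') = (44, 3)`, order 69 cases
`(26,24,3)`, `(32,24,9)`, order 55 case `(58,8,3)`; kernel here for 123:
* **`hadamard668_order123_fpf`**: `π^123 = κ^123 = 1` with both parts nontrivial ⇒ the `3`-parts `π^41`, `κ^41` fix
  EXACTLY `164` rows / columns and NO row or column is fixed by both parts (the element acts fixed-point-freely).
  [Gen 17 left `(164, 0)` or `(44, 3)` on each side; `signedAut_card_fixed_eq` (gen 18) equalises the two sides; in case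
  `(44, 3)` two rows fixed by both parts give `A = Σ_{3 common cols}` odd with `|A| ≤ 3`, `B₃ = Σ` over the `41` other
  columns of `Fix κ^41` with `41 ∣ B₃`, `B₃` odd, and `B₄₁ = Σ` over the `9` other columns of `Fix κ^3` with `3 ∣ B₄₁`,
  `|B₄₁| ≤ 9`; then `41 ∣ A + B₄₁` forces `A = -B₄₁ ∈ 3ℤ`, i.e. `A = ±3`, and `3 ∣ A + B₃` forces `3 ∣ B₃ = ±41` — false.]
STRUCTURE only: order 123 is not excluded.  Ours, not literature; no `sorry`, no definitions, default heartbeats.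
-/

namespace Summit.Ventures.DiscreteObjects.Hadamard

open Finset BigOperators Matrix

open Literature.Combinatorics.Designs.GoethalsSeidel (IsHadamardMatrix)

variable {ι : Type*} [Fintype ι] [DecidableEq ι]

/-- **`q ∣ Σ_{σ y = y, τ y ≠ y} g`** for commuting `σ, τ` with `τ^q = 1` (`q` prime) and `τ`-invariant `g`
(the `τ`-orbits inside `Fix σ`). -/
theorem dvd_sum_fixed_moved (σ τ : Equiv.Perm ι) {q : ℕ} (hq : q.Prime) (hτ : τ ^ q = 1) (hc : Commute σ τ)
    (g : ι → ℤ) (hg : ∀ y, g (τ y) = g y) :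
    (q : ℤ) ∣ ∑ y ∈ univ.filter (fun y => σ y = y ∧ τ y ≠ y), g y := by
  classical
  have hinv : ∀ y, σ y = y ↔ σ (τ y) = τ y := by
    intro y
    have e1 : σ (τ y) = τ (σ y) := by
      have := congrArg (fun f : Equiv.Perm ι => f y) hc.eq
      simpa [Equiv.Perm.mul_apply] using this
    rw [e1]
    constructor
    · intro h; rw [h]
    · intro h; exact τ.injective h
  have hinv' : ∀ y, σ (τ y) = τ y ↔ σ y = y := fun y => (hinv y).symm
  set ρ : Equiv.Perm {y // σ y = y} := τ.subtypePerm hinv' with hρ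
  have hρq : ρ ^ q = 1 := by
    ext ⟨y, hy⟩
    have h1 : (((ρ ^ q) ⟨y, hy⟩ : {y // σ y = y}) : ι) = (τ ^ q) y := by
      rw [hρ, Equiv.Perm.subtypePerm_pow]; rfl
    rw [h1, hτ]; rfl
  have hsub := dvd_sum_moved ρ hq hρq (fun z => g z.1) (fun z₀ _ i => by
    show g (((ρ ^ i) z₀ : {y // σ y = y}) : ι) = g z₀.1
    have : (((ρ ^ i) z₀ : {y // σ y = y}) : ι) = (τ ^ i) z₀.1 := by
      rw [hρ, Equiv.Perm.subtypePerm_pow]; rfl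
    rw [this, apply_pow_eq_of_invariant τ g hg])
  have hset2 : (univ.filter fun y => σ y = y ∧ τ y ≠ y) =
      (univ.filter fun y => σ y = y).filter (fun y => τ y ≠ y) := by
    ext y; simp only [Finset.mem_filter, Finset.mem_univ, true_and]
  rw [hset2, Finset.sum_filter,
    Finset.sum_subtype (univ.filter fun y => σ y = y) (p := fun y => σ y = y) (fun y => by simp),
    ← Finset.sum_filter]
  have e : (univ.filter fun z : {y // σ y = y} => τ z.1 ≠ z.1) = univ.filter fun z => ρ z ≠ z := by
    ext z
    simp only [Finset.mem_filter, Finset.mem_univ, true_and, hρ]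
    rw [not_iff_not]
    constructor
    · intro h; exact Subtype.ext (by rw [Equiv.Perm.subtypePerm_apply]; exact h)
    · intro h; have := congrArg Subtype.val h; rw [Equiv.Perm.subtypePerm_apply] at this; exact this
  rw [e]
  exact hsub

omit [Fintype ι] [DecidableEq ι] in
/-- the integer system of order 123, case `(44, 3)`, is infeasible (staged `omega`: the one-shot call does not close it) -/
lemma order123_arith (m₁ m₂ m₃ : ℕ) (k₁ k₂ k₃ k₄ : ℤ) (hm₁ : m₁ ≤ 3) (hm₂ : m₂ ≤ 41) (hm₃ : m₃ ≤ 9)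
    (hk₁ : (3:ℤ) - 2 * (m₁:ℤ) + ((9:ℤ) - 2 * (m₃:ℤ)) = 41 * k₁)
    (hk₂ : (3:ℤ) - 2 * (m₁:ℤ) + ((41:ℤ) - 2 * (m₂:ℤ)) = 3 * k₂)
    (hk₃ : (9:ℤ) - 2 * (m₃:ℤ) = 3 * k₃) (hk₄ : (41:ℤ) - 2 * (m₂:ℤ) = 41 * k₄) : False := by
  have h4 : m₂ = 0 ∨ m₂ = 41 := by clear hk₁ hk₂ hk₃ hm₁ hm₃; omega
  have h1 : m₁ + m₃ = 6 := by clear hk₂ hk₃ hk₄ hm₂ h4; omega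
  have h3 : m₃ = 0 ∨ m₃ = 3 ∨ m₃ = 6 ∨ m₃ = 9 := by clear hk₁ hk₂ hk₄ hm₁ hm₂ h4 h1; omega
  clear hk₁ hk₃ hk₄
  rcases h4 with rfl | rfl <;> rcases h3 with rfl | rfl | rfl | rfl <;> omega

section pair
variable {H : Matrix ι ι ℤ} {π κ : Equiv.Perm ι} {d e : ι → ℤ}

omit [Fintype ι] [DecidableEq ι] in
/-- the product of two fixed rows of equal sign is invariant under the column permutation -/
lemma pair_prod_invariant (haut : IsSignedAut H π κ d e) {x x' : ι} (hx : π x = x) (hx' : π x' = x')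
    (hdd : d x = d x') (y : ι) : H x (κ y) * H x' (κ y) = H x y * H x' y := by
  have h1 := haut.2.2 x y
  have h2 := haut.2.2 x' y
  rw [hx] at h1; rw [hx'] at h2
  rw [h1, h2, ← hdd]
  have hd2 : d x * d x = 1 := pm_mul_self (haut.1 x)
  have he2 : e y * e y = 1 := pm_mul_self (haut.2.1 y)
  calc d x * e y * H x y * (d x * e y * H x' y) = (d x * d x) * (e y * e y) * (H x y * H x' y) := by ring
    _ = H x y * H x' y := by rw [hd2, he2, one_mul, one_mul]

/-- **The four divisibilities for a pair of rows fixed by both parts of an element of order `pq`.** -/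
theorem composite_pair_dvd (hH : IsHadamardMatrix H) (haut : IsSignedAut H π κ d e) {p q : ℕ}
    (hp : p.Prime) (hq : q.Prime) (hκ : κ ^ (p * q) = 1)
    {x x' : ι} (hxx' : x ≠ x') (hxp : (π ^ p) x = x) (hxq : (π ^ q) x = x)
    (hx'p : (π ^ p) x' = x') (hx'q : (π ^ q) x' = x')
    (hcp : ∃ j, (κ ^ p) j = j) (hcq : ∃ j, (κ ^ q) j = j) :
    ((q : ℤ) ∣ ∑ y ∈ univ.filter (fun y => (κ ^ p) y = y), H x y * H x' y) ∧
    ((p : ℤ) ∣ ∑ y ∈ univ.filter (fun y => (κ ^ q) y = y), H x y * H x' y) ∧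
    ((p : ℤ) ∣ ∑ y ∈ univ.filter (fun y => (κ ^ p) y = y ∧ (κ ^ q) y ≠ y), H x y * H x' y) ∧
    ((q : ℤ) ∣ ∑ y ∈ univ.filter (fun y => (κ ^ q) y = y ∧ (κ ^ p) y ≠ y), H x y * H x' y) := by
  have hautp := isSignedAut_pow haut p
  have hautq := isSignedAut_pow haut q
  obtain ⟨jp, hjp⟩ := hcp
  obtain ⟨jq, hjq⟩ := hcq
  -- exponents of the parts
  have hκpq : (κ ^ p) ^ (q * q) = 1 := by
    rw [← pow_mul, ← mul_assoc, pow_mul, hκ, one_pow]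
  have hκqp : (κ ^ q) ^ (p * p) = 1 := by
    rw [← pow_mul, show q * (p * p) = (p * q) * p by ring, pow_mul, hκ, one_pow]
  have hκpq1 : (κ ^ p) ^ q = 1 := by rw [← pow_mul, hκ]
  have hκqp1 : (κ ^ q) ^ p = 1 := by rw [← pow_mul, mul_comm, hκ]
  -- equal signs under each part
  have hddp : cyc π d x p = cyc π d x' p := by
    rw [signedAut_fixed_sign hH.1 hautp hxp hjp, signedAut_fixed_sign hH.1 hautp hx'p hjp]
  have hddq : cyc π d x q = cyc π d x' q := by
    rw [signedAut_fixed_sign hH.1 hautq hxq hjq, signedAut_fixed_sign hH.1 hautq hx'q hjq]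
  have hinvp : ∀ y, H x ((κ ^ p) y) * H x' ((κ ^ p) y) = H x y * H x' y :=
    pair_prod_invariant hautp hxp hx'p hddp
  have hinvq : ∀ y, H x ((κ ^ q) y) * H x' ((κ ^ q) y) = H x y * H x' y :=
    pair_prod_invariant hautq hxq hx'q hddq
  have hc : Commute (κ ^ p) (κ ^ q) := (Commute.refl κ).pow_pow p q
  refine ⟨?_, ?_, ?_, ?_⟩
  · exact fixedRows_inner_dvd hH hautp hq hκpq hxx' hxp hx'p hddp
  · exact fixedRows_inner_dvd hH hautq hp hκqp hxx' hxq hx'q hddq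
  · exact dvd_sum_fixed_moved (κ ^ p) (κ ^ q) hp hκqp1 hc _ hinvq
  · exact dvd_sum_fixed_moved (κ ^ q) (κ ^ p) hq hκpq1 hc.symm _ hinvp

/-- splitting a fixed-set sum by the other part -/
lemma sum_fixed_split (σ τ : Equiv.Perm ι) (g : ι → ℤ) :
    ∑ y ∈ univ.filter (fun y => σ y = y), g y =
      (∑ y ∈ univ.filter (fun y => σ y = y ∧ τ y = y), g y) +
        ∑ y ∈ univ.filter (fun y => σ y = y ∧ τ y ≠ y), g y := by
  rw [← Finset.sum_filter_add_sum_filter_not (univ.filter fun y => σ y = y) (fun y => τ y = y)]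
  congr 1
  · rw [Finset.filter_filter]
  · rw [Finset.filter_filter]

/-- **ORDER 123 = 3·41: the element acts fixed-point-freely; its 3-part fixes exactly 164 rows and 164 columns.**
For a signed automorphism `(π, κ, d, e)` of an H(668) with `π^123 = κ^123 = 1` and both parts nontrivial.
Structure only. -/
theorem hadamard668_order123_fpf (hH : IsHadamardMatrix H) (hι : Fintype.card ι = 668)
    (π κ : Equiv.Perm ι) (d e : ι → ℤ) (haut : IsSignedAut H π κ d e)
    (hπ : π ^ (3 * 41) = 1) (hκ : κ ^ (3 * 41) = 1) (h41 : π ^ 41 ≠ 1 ∨ κ ^ 41 ≠ 1) (h3 : π ^ 3 ≠ 1 ∨ κ ^ 3 ≠ 1) :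
    (univ.filter fun j => (κ ^ 41) j = j).card = 164 ∧ (univ.filter fun j => (κ ^ 41) j = j ∧ (κ ^ 3) j = j).card = 0 ∧
    (univ.filter fun i => (π ^ 41) i = i).card = 164 ∧ (univ.filter fun i => (π ^ 41) i = i ∧ (π ^ 3) i = i).card = 0 := by
  have hcard : (Fintype.card ι : ℤ) ≠ 0 := by rw [hι]; norm_num
  obtain ⟨hC, hR⟩ := hadamard668_order123_structure hH hι π κ d e haut hπ hκ h41 h3
  -- the 3-parts fix as many rows as columns (FixedGramModP, p = 3)
  have hπ41 : (π ^ 41) ^ (3 * 3) = 1 := by rw [← pow_mul]; rw [show 41 * (3 * 3) = 3 * 41 * 3 by norm_num, pow_mul, hπ, one_pow]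
  have hκ41 : (κ ^ 41) ^ (3 * 3) = 1 := by rw [← pow_mul]; rw [show 41 * (3 * 3) = 3 * 41 * 3 by norm_num, pow_mul, hκ, one_pow]
  have hR3 : ¬ 3 ∣ (univ.filter fun i => (π ^ 41) i = i).card := by
    rcases hR with ⟨h, -⟩ | ⟨h, -⟩ <;> omega
  have hC3 : ¬ 3 ∣ (univ.filter fun j => (κ ^ 41) j = j).card := by
    rcases hC with ⟨h, -⟩ | ⟨h, -⟩ <;> omega
  obtain ⟨heq, -⟩ := signedAut_card_fixed_eq hH (isSignedAut_pow haut 41) (by norm_num : (3 : ℕ).Prime) hπ41 hκ41 hR3 hC3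
  -- exclude the case (44, 3)
  rcases hC with ⟨hC164, hC0⟩ | ⟨hC44, hC3'⟩
  · rcases hR with ⟨hR164, hR0⟩ | ⟨hR44, -⟩
    · exact ⟨hC164, hC0, hR164, hR0⟩
    · exfalso; omega
  · exfalso
    rcases hR with ⟨hR164, -⟩ | ⟨hR44, hR3'⟩
    · omega
    -- two distinct rows fixed by both parts
    have h2 : 1 < (univ.filter fun i => (π ^ 41) i = i ∧ (π ^ 3) i = i).card := by omega
    obtain ⟨x, hx, x', hx', hxx'⟩ := Finset.one_lt_card.mp h2
    simp only [Finset.mem_filter, Finset.mem_univ, true_and] at hx hx'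
    -- fixed columns of each part exist
    have h41col : (univ.filter fun j => (κ ^ 3) j = j).card = 12 := by
      have hπ3 : (π ^ 3) ^ 41 = 1 := by rw [← pow_mul]; exact hπ
      have hκ3 : (κ ^ 3) ^ 41 = 1 := by rw [← pow_mul]; exact hκ
      obtain ⟨eRC, h12⟩ := hadamard668_signedAut_fixedRows hH hι 41 (by norm_num) (by norm_num) (π ^ 3) (κ ^ 3) _ _
        (isSignedAut_pow haut 3) hπ3 hκ3 h3
      have h12R : (univ.filter fun i => (π ^ 3) i = i).card = 12 := by
        rcases h12 with ⟨h, -⟩ | ⟨h, -⟩ | ⟨h, -⟩ | ⟨-, h⟩ | ⟨h, -⟩ | ⟨h, -⟩ <;> first | exact h | norm_num at h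
      rw [← eRC]; exact h12R
    have hcp : ∃ j, (κ ^ 3) j = j := by
      have h0 : 0 < (univ.filter fun j => (κ ^ 3) j = j).card := by rw [h41col]; norm_num
      obtain ⟨j, hj⟩ := Finset.card_pos.mp h0
      exact ⟨j, by simpa using hj⟩
    have hcq : ∃ j, (κ ^ 41) j = j := by
      have h0 : 0 < (univ.filter fun j => (κ ^ 41) j = j).card := by rw [hC44]; norm_num
      obtain ⟨j, hj⟩ := Finset.card_pos.mp h0
      exact ⟨j, by simpa using hj⟩
    obtain ⟨d41, d3, d3', d41'⟩ := composite_pair_dvd hH haut (by norm_num : (3 : ℕ).Prime) (by norm_num : (41 : ℕ).Prime)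
      hκ hxx' hx.2 hx.1 hx'.2 hx'.1 hcp hcq
    -- d41 : 41 ∣ Σ_{Fix κ^3};  d3 : 3 ∣ Σ_{Fix κ^41};  d3' : 3 ∣ Σ_{Fix κ^3 ∖ Fix κ^41};  d41' : 41 ∣ Σ_{Fix κ^41 ∖ Fix κ^3}
    -- cardinalities of the pieces
    obtain ⟨c1, -, c2, -, -, -⟩ := counting_cols κ (by norm_num : (3 : ℕ).Prime) (by norm_num : (41 : ℕ).Prime) hκ
    -- c1 : #Fix(κ^3) = #(κ^41 ≠ ∧ κ^3 =) + #both ; c2 : #Fix(κ^41) = #(κ^3 ≠ ∧ κ^41 =) + #both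
    have hsetA : (univ.filter fun j => (κ ^ 3) j = j ∧ (κ ^ 41) j = j) =
        univ.filter fun j => (κ ^ 41) j = j ∧ (κ ^ 3) j = j := by
      ext j; simp only [Finset.mem_filter, Finset.mem_univ, true_and]; exact And.comm
    have hsetB3 : (univ.filter fun j => (κ ^ 41) j = j ∧ (κ ^ 3) j ≠ j) =
        univ.filter fun j => (κ ^ 3) j ≠ j ∧ (κ ^ 41) j = j := by
      ext j; simp only [Finset.mem_filter, Finset.mem_univ, true_and]; exact And.comm
    have hsetB41 : (univ.filter fun j => (κ ^ 3) j = j ∧ (κ ^ 41) j ≠ j) =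
        univ.filter fun j => (κ ^ 41) j ≠ j ∧ (κ ^ 3) j = j := by
      ext j; simp only [Finset.mem_filter, Finset.mem_univ, true_and]; exact And.comm
    have hcardB3 : (univ.filter fun j => (κ ^ 41) j = j ∧ (κ ^ 3) j ≠ j).card = 41 := by
      rw [hsetB3]; omega
    have hcardB41 : (univ.filter fun j => (κ ^ 3) j = j ∧ (κ ^ 41) j ≠ j).card = 9 := by
      rw [hsetB41]; omega
    -- the splits
    rw [sum_fixed_split (κ ^ 3) (κ ^ 41), hsetA] at d41
    rw [sum_fixed_split (κ ^ 41) (κ ^ 3)] at d3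
    -- bounds and parities
    have hpm : ∀ (S : Finset ι), ∀ y ∈ S, H x y * H x' y = 1 ∨ H x y * H x' y = -1 := fun S y _ => by
      rcases hH.1 x y with h1 | h1 <;> rcases hH.1 x' y with h2 | h2 <;> simp [h1, h2]
    obtain ⟨m₁, hm₁, hA⟩ := sum_pm_eq_card_sub_two_mul (univ.filter fun j => (κ ^ 41) j = j ∧ (κ ^ 3) j = j) _ (hpm _)
    obtain ⟨m₂, hm₂, hB3⟩ := sum_pm_eq_card_sub_two_mul (univ.filter fun j => (κ ^ 41) j = j ∧ (κ ^ 3) j ≠ j) _ (hpm _)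
    obtain ⟨m₃, hm₃, hB41⟩ := sum_pm_eq_card_sub_two_mul (univ.filter fun j => (κ ^ 3) j = j ∧ (κ ^ 41) j ≠ j) _ (hpm _)
    rw [hC3'] at hm₁ hA
    rw [hcardB3] at hm₂ hB3
    rw [hcardB41] at hm₃ hB41
    rw [hA, hB41] at d41
    rw [hA, hB3] at d3
    rw [hB41] at d3'
    rw [hB3] at d41'
    obtain ⟨k₁, hk₁⟩ := d41
    obtain ⟨k₂, hk₂⟩ := d3
    obtain ⟨k₃, hk₃⟩ := d3'
    obtain ⟨k₄, hk₄⟩ := d41'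
    push_cast at hk₁ hk₂ hk₃ hk₄
    have hk₁' : (3:ℤ) - 2 * (m₁:ℤ) + ((9:ℤ) - 2 * (m₃:ℤ)) = 41 * k₁ := by linarith
    have hk₂' : (3:ℤ) - 2 * (m₁:ℤ) + ((41:ℤ) - 2 * (m₂:ℤ)) = 3 * k₂ := by linarith
    have hk₃' : (9:ℤ) - 2 * (m₃:ℤ) = 3 * k₃ := by linarith
    have hk₄' : (41:ℤ) - 2 * (m₂:ℤ) = 41 * k₄ := by linarith
    exact order123_arith m₁ m₂ m₃ k₁ k₂ k₃ k₄ hm₁ hm₂ hm₃ hk₁' hk₂' hk₃' hk₄'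

end pair

end Summit.Ventures.DiscreteObjects.Hadamard
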